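import Summits.HodgeConjecture.HodgeConjecture.Theses.TropicalWeilObstruction
import Summits.HodgeConjecture.HodgeConjecture.Theorems.TropicalWeilObstructionTropicalHodgeBoundRationalHodgeCoordinates
import Summits.HodgeConjecture.HodgeConjecture.Theorems.TropicalWeilObstructionTropicalHodgeBoundClassesEigenwave
import HarnessLib

/-!
# Route `TropicalWeilObstruction` (Kontsevich's tropical test — NEGATION SINK, exploration, no summit claim):
# the integral tropical Hodge `(4,4)`-lattice of a very general tropical Weil eightfold is EXACTLY
# `ℤθ₄ ⊕ ℤ Re w ⊕ ℤ Im w`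

Negation-sink bookkeeping of the cell `pub-hodge-tropical` (seat tropical-2), completing the independent read
`K3-READ.md` of the closed crux K3 (`TropicalHodgeBound`, p322554), point §3(c): "rank is proved `≤ 3` for cycle
classes, not `= 3`; whether `Re w, Im w` are tropical Hodge classes is not proved in-tree for `g = 8`".

Setting: `X_Q = ℝ⁸/Qℤ⁸`, `Q` symmetric positive definite commuting with `J = weilJ 4`. The tropical homology group
`H_{4,4}(X_Q; ℤ) = ⋀⁴Γ₁ ⊗ ⋀⁴Γ₂` (`Γ₁ = Qℤ⁸`, `Γ₂ = ℤ⁸`) consists, in the all-maps Plücker coordinates of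
`TropicalTorusCycle.cyc`, of the tables `(S,S') ↦ (1/4!) Σ_I det Q[S,I] · y(I,S')` with `y` an integer table
alternating in both words (display-only notation `cl⟦Q⟧ y` below; `y` = the coefficients on `γ_I ⊗ e_{S'}`,
`γ_I = Qe_{I₁} ∧ … ∧ Qe_{I₄}`); the tropical Hodge classes are those killed by the eigenwave
[cite: Zharkov2020TropicalWeil, p. 1] — here in the coordinates of `cyc_eigenwave` (p317436; for the symmetric
tables at hand the same condition as Zharkov's `ker φ`, see `…ClassesEigenwave` and `cyc_eigenwave_symm` in
`…TropicalHodgeBoundWeilClassesIndependent`).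

* `thetaClass_eq_cl`, `weilClassRe_eq_cl`, `weilClassIm_eq_cl` — `θ₄(Q)`, `Re w(Q)`, `Im w(Q)` are INTEGRAL classes
  (`y = θ̃ = det 1[I,S']`, `Re w̃`, `Im w̃` with `w̃(I,S') = det Ω[I]·det Ω[S'] ∈ ℤ[i]`; Cauchy–Binet, from p322554).
* `cl_eq_of_eigenwave` — **classification** (`Q` symmetric, `QJ = JQ`, `IsWeilGeneric 4 Q`): an integral class
  killed by the eigenwave is an INTEGER combination `a θ₄ + b Re w + c Im w` — K3's kernel-checked rank certificate
  (`Chk.rel_all`, `Chk.y_eq_classes_of_rel`; 51 `decide` chunks, p319305–p321949) run on a general table `y`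
  instead of `intCoord Z`.
* `integralHodgeClass_iff` — with `…ClassesEigenwave` (the three classes ARE killed) the converse holds, so for a
  Weil-generic `Q ≻ 0`: **`Hdg^{4,4}(X_Q; ℤ) = {a θ₄ + b Re w + c Im w : a, b, c ∈ ℤ}`**; by
  `linearIndependent_thetaClass_weilClasses` (sibling file `…WeilClassesIndependent`) this is a free lattice of rank
  EXACTLY `3` — Zharkov's "two extra Hodge classes", for `g = 8`, and no more. The sibling file also records what
  the open crux K1 then says (effective classes span at most the theta line: the tropical Hodge conjecture would
  fail in bidegree `(4,4)` with the Weil classes non-effective).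

HONEST STATUS. K1 (`TropicalWeilVanishing`) is an OPEN problem of tropical geometry and K2 (`MumfordWeilShadow`)
is XL; nothing here decides either, and nothing here bears on the Hodge conjecture. No definition (display-only
notation), no named fact, no sorry.
References: [Zharkov2020TropicalWeil] I. Zharkov, arXiv:2002.02347, pp. 1–2; [MikhalkinZharkov2014Eigenwave]
G. Mikhalkin, I. Zharkov, LN UMI 15 (2014), Prop. 4.3, Thm. 5.4.
-/

set_option linter.dupNamespace false

noncomputable section

open scoped BigOperators
open Matrix
open Literature.AlgebraicGeometry.Tropical

namespace Summit.HodgeConjecture.HodgeConjecture.Theorems.TropicalHodgeBound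

/-! ## §0 Display-only notation (the K3 skeleton's local definitions, verbatim bodies; nothing is defined) -/

/-- The skeleton's `thetaClass n Q`. -/
local notation3 (prettyPrint := false) "θ⟦" n "⟧" Q:max =>
  (fun S S' : Fin n → Fin (2 * n) => Matrix.det (Matrix.submatrix Q S S'))

/-- The skeleton's `omegaFrame n` (`Ω = Pᴴ`). -/
local notation3 (prettyPrint := false) "Ω⟦" n "⟧" =>
  (Matrix.of fun (a : Fin (2 * n)) (b : Fin n) =>
    (if (a : ℕ) = (b : ℕ) then (1 : ℂ) else 0) - (if (a : ℕ) = (b : ℕ) + n then Complex.I else 0))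

/-- The skeleton's `weilClassC n Q` (`w(Q) = (⋀ⁿQ ⊗ 1)(Ω ⊗ Ω)`). -/
local notation3 (prettyPrint := false) "wC⟦" n "⟧" Q:max =>
  (fun S S' : Fin n → Fin (2 * n) =>
    Matrix.det (Matrix.submatrix (Matrix.map Q ((↑) : ℝ → ℂ) * Ω⟦n⟧) S id) *
      Matrix.det (Matrix.submatrix (Ω⟦n⟧) S' id))

/-- The skeleton's `weilClassRe n Q` (`w₁ = Re w`). -/
local notation3 (prettyPrint := false) "wRe⟦" n "⟧" Q:max =>
  (fun S S' : Fin n → Fin (2 * n) => Complex.re ((wC⟦n⟧ Q) S S'))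

/-- The skeleton's `weilClassIm n Q` (`w₂ = Im w`). -/
local notation3 (prettyPrint := false) "wIm⟦" n "⟧" Q:max =>
  (fun S S' : Fin n → Fin (2 * n) => Complex.im ((wC⟦n⟧ Q) S S'))

/-- NEW display-only notation: the INTEGRAL class with coordinate table `y` (`n = 4`),
`cl⟦Q⟧ y (S,S') = (1/4!) Σ_I det Q[S,I] · y(I,S')` — for `y` alternating in both words, the general element of
`⋀⁴(Qℤ⁸) ⊗ ⋀⁴ℤ⁸ = H_{4,4}(X_Q; ℤ)` in all-maps Plücker coordinates. Nothing is defined. -/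
local notation3 (prettyPrint := false) "cl⟦" Q "⟧" y:max =>
  (fun S S' : Fin 4 → Fin (2 * 4) =>
    (1 / 24 : ℝ) * ∑ I : Fin 4 → Fin (2 * 4), Matrix.det (Matrix.submatrix Q S I) * ((y I S' : ℤ) : ℝ))

/-! ## §1 The three classes are integral -/

section Integral

variable (Q : Matrix (Fin (2 * 4)) (Fin (2 * 4)) ℝ)

/-- The integral class of the combination `A θ̃ - B Re w̃ - C Im w̃` is `A θ₄(Q) - B Re w(Q) - C Im w(Q)`
(Cauchy–Binet `Σ_I det Q[S,I] θ̃(I,S') = 4!·θ₄`, `Σ_I det Q[S,I] w̃(I,S') = 4!·w`, from p322554).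
[cite: MikhalkinZharkov2014Eigenwave, Prop. 4.3] [cite: Zharkov2020TropicalWeil, §2] -/
theorem cl_classes (A B C : ℤ) :
    cl⟦Q⟧ (fun I J => A * Chk.thetaZ I J - B * (Chk.wG I J).re - C * (Chk.wG I J).im) =
      (A : ℝ) • θ⟦4⟧ Q - (B : ℝ) • wRe⟦4⟧ Q - (C : ℝ) • wIm⟦4⟧ Q := by
  funext S S'
  simp only [Pi.sub_apply, Pi.smul_apply, smul_eq_mul]
  -- the three Cauchy–Binet sums
  have hθ := sum_det_mul_thetaZ Q S S'
  have hw := sum_det_mul_wG Q S S'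
  have hre : ∑ I : Fin 4 → Fin (2 * 4), (Q.submatrix S I).det * (((Chk.wG I S').re : ℤ) : ℝ) =
      24 * ((wC⟦4⟧ Q) S S').re := by
    have := congrArg Complex.re hw
    rw [Complex.re_sum] at this
    simp only [Complex.re_ofReal_mul, ← GaussianInt.intCast_re] at this
    rw [this]
    beta_reduce
    simp [Complex.mul_re]
  have him : ∑ I : Fin 4 → Fin (2 * 4), (Q.submatrix S I).det * (((Chk.wG I S').im : ℤ) : ℝ) =
      24 * ((wC⟦4⟧ Q) S S').im := by
    have := congrArg Complex.im hw
    rw [Complex.im_sum] at this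
    simp only [Complex.im_ofReal_mul, ← GaussianInt.intCast_im] at this
    rw [this]
    beta_reduce
    simp [Complex.mul_im]
  have hsplit : ∑ I : Fin 4 → Fin (2 * 4), (Q.submatrix S I).det *
      (((A * Chk.thetaZ I S' - B * (Chk.wG I S').re - C * (Chk.wG I S').im : ℤ) : ℝ)) =
      (A : ℝ) * ∑ I : Fin 4 → Fin (2 * 4), (Q.submatrix S I).det * ((Chk.thetaZ I S' : ℤ) : ℝ) -
      (B : ℝ) * ∑ I : Fin 4 → Fin (2 * 4), (Q.submatrix S I).det * (((Chk.wG I S').re : ℤ) : ℝ) -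
      (C : ℝ) * ∑ I : Fin 4 → Fin (2 * 4), (Q.submatrix S I).det * (((Chk.wG I S').im : ℤ) : ℝ) := by
    rw [Finset.mul_sum, Finset.mul_sum, Finset.mul_sum, ← Finset.sum_sub_distrib, ← Finset.sum_sub_distrib]
    refine Finset.sum_congr rfl fun I _ => ?_
    push_cast
    ring
  rw [hsplit, hθ, hre, him]
  ring

/-- **`θ₄(Q)` is an integral class**: `θ₄(Q) = cl⟦Q⟧ θ̃`, `θ̃(I,S') = det 1[I,S']` (`= Σ_I γ_I ⊗ e_I`).
[cite: Zharkov2020TropicalWeil, p. 2] -/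
theorem thetaClass_eq_cl : θ⟦4⟧ Q = cl⟦Q⟧ (fun I J => Chk.thetaZ I J) := by
  have h := cl_classes Q 1 0 0
  simp only [Int.cast_one, one_smul, Int.cast_zero, zero_smul, sub_zero] at h
  rw [← h]
  simp

/-- **`Re w(Q)` is an integral class**: `Re w(Q) = cl⟦Q⟧ (Re w̃)`, `w̃(I,S') = det Ω[I]·det Ω[S'] ∈ ℤ[i]`.
[cite: Zharkov2020TropicalWeil, p. 2] -/
theorem weilClassRe_eq_cl : wRe⟦4⟧ Q = cl⟦Q⟧ (fun I J => (Chk.wG I J).re) := by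
  have h := cl_classes Q 0 (-1) 0
  simp only [Int.cast_zero, zero_smul, Int.cast_neg, Int.cast_one, neg_smul, one_smul, sub_neg_eq_add,
    zero_add, sub_zero] at h
  rw [← h]
  simp

/-- **`Im w(Q)` is an integral class**: `Im w(Q) = cl⟦Q⟧ (Im w̃)`. [cite: Zharkov2020TropicalWeil, p. 2] -/
theorem weilClassIm_eq_cl : wIm⟦4⟧ Q = cl⟦Q⟧ (fun I J => (Chk.wG I J).im) := by
  have h := cl_classes Q 0 0 (-1)
  simp only [Int.cast_zero, zero_smul, Int.cast_neg, Int.cast_one, neg_smul, one_smul, sub_neg_eq_add,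
    sub_zero, zero_add] at h
  rw [← h]
  simp

end Integral

/-! ## §2 Classification of the integral Hodge classes at a Weil-generic period -/

section Classification

variable (Q : Matrix (Fin (2 * 4)) (Fin (2 * 4)) ℝ)

/-- **Every integral tropical Hodge `(4,4)`-class is an integer combination of `θ₄, Re w, Im w`** (Q symmetric,
`QJ = JQ`, Weil-generic): if `y` is an integer table alternating in both words and the class `cl⟦Q⟧ y` is killed by
the eigenwave, then `cl⟦Q⟧ y = a θ₄(Q) + b Re w(Q) + c Im w(Q)` with `a, b, c ∈ ℤ`. This is K3's kernel-checked
rank certificate (genericity turns the eigenwave identity into one integer equation per monomial; the checker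
resolves all `4900` unknowns onto `y₀, y₄, y₁₄`) run on a general `y`.
[cite: Zharkov2020TropicalWeil, §2] [cite: MikhalkinZharkov2014Eigenwave, Thm. 5.4] -/
theorem cl_eq_of_eigenwave (hS : ∀ α β, Q α β = Q β α) (hJ : Q * weilJ 4 = weilJ 4 * Q)
    (hgen : IsWeilGeneric 4 Q) (y : (Fin 4 → Fin (2 * 4)) → (Fin 4 → Fin (2 * 4)) → ℤ)
    (hyI : ∀ (c d : Fin 4 → Fin (2 * 4)) (τ : Equiv.Perm (Fin 4)),
      y (c ∘ τ) d = ((Equiv.Perm.sign τ : ℤˣ) : ℤ) * y c d)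
    (hyJ : ∀ (c d : Fin 4 → Fin (2 * 4)) (τ : Equiv.Perm (Fin 4)),
      y c (d ∘ τ) = ((Equiv.Perm.sign τ : ℤˣ) : ℤ) * y c d)
    (heig : ∀ (K' : Fin 5 → Fin (2 * 4)) (J' : Fin 3 → Fin (2 * 4)),
      ∑ m : Fin 5, (-1 : ℝ) ^ (m : ℕ) * (cl⟦Q⟧ y) (fun a => K' (m.succAbove a)) (Fin.cons (K' m) J') = 0) :
    ∃ a b c : ℤ, cl⟦Q⟧ y = (a : ℝ) • θ⟦4⟧ Q + (b : ℝ) • wRe⟦4⟧ Q + (c : ℝ) • wIm⟦4⟧ Q := by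
  -- the eigenwave identity without the factor `1/24`
  have heig' : ∀ (K' : Fin 5 → Fin (2 * 4)) (J' : Fin 3 → Fin (2 * 4)),
      ∑ m : Fin 5, (-1 : ℝ) ^ (m : ℕ) * ∑ I : Fin 4 → Fin (2 * 4),
        (Q.submatrix (fun a => K' (m.succAbove a)) I).det * (y I (Fin.cons (K' m) J') : ℝ) = 0 := by
    intro K' J'
    have h := heig K' J'
    beta_reduce at h
    have e : ∑ m : Fin 5, (-1 : ℝ) ^ (m : ℕ) * ∑ I : Fin 4 → Fin (2 * 4),
        (Q.submatrix (fun a => K' (m.succAbove a)) I).det * (y I (Fin.cons (K' m) J') : ℝ) =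
        24 * ∑ m : Fin 5, (-1 : ℝ) ^ (m : ℕ) * ((1 / 24 : ℝ) * ∑ I : Fin 4 → Fin (2 * 4),
          (Q.submatrix (fun a => K' (m.succAbove a)) I).det * (y I (Fin.cons (K' m) J') : ℝ)) := by
      rw [Finset.mul_sum]
      refine Finset.sum_congr rfl fun m _ => ?_
      ring
    rw [e, h, mul_zero]
  -- (G) the coefficient equations, (C) the certificate
  have heq := fun K' J' m₀ c₀ => coeffEquation_eq_zero hS hJ hgen y hyI K' J' (heig' K' J') m₀ c₀
  have hrel : ∀ u < 4900, Chk.yvOf y u = Chk.relRHS (Chk.yvOf y) u :=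
    fun u hu => Chk.rel_all y hyI hyJ heq u hu
  have hcls := Chk.y_eq_classes_of_rel y hyI hyJ hrel
  refine ⟨Chk.yvOf y 0 + Chk.yvOf y 14, -Chk.yvOf y 14, -Chk.yvOf y 4, ?_⟩
  have hy : cl⟦Q⟧ y = cl⟦Q⟧ (fun I J => (Chk.yvOf y 0 + Chk.yvOf y 14) * Chk.thetaZ I J -
      Chk.yvOf y 14 * (Chk.wG I J).re - Chk.yvOf y 4 * (Chk.wG I J).im) := by
    funext S S'
    beta_reduce
    congr 1
    refine Finset.sum_congr rfl fun I _ => ?_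
    rw [hcls I S']
  rw [hy, cl_classes]
  simp only [Int.cast_add, Int.cast_neg, neg_smul]
  abel

/-- **The integral Hodge `(4,4)`-lattice of a very general tropical Weil eightfold** (`Q ≻ 0`, `QJ = JQ`,
`IsWeilGeneric 4 Q`): a table `C` is an integral class killed by the eigenwave iff
`C = a θ₄(Q) + b Re w(Q) + c Im w(Q)` for some `a, b, c ∈ ℤ`. (`⇒`: `cl_eq_of_eigenwave`; `⇐`: the three classes are
integral — §1 — and killed — `thetaClass_eigenwave`, `weilClassRe_eigenwave`, `weilClassIm_eigenwave`.) With
`linearIndependent_thetaClass_weilClasses`: `Hdg^{4,4}(X_Q; ℤ) = ℤθ₄ ⊕ ℤ Re w ⊕ ℤ Im w`, free of rank `3`.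
[cite: Zharkov2020TropicalWeil, pp. 1–2] [cite: MikhalkinZharkov2014Eigenwave, Thm. 5.4] -/
theorem integralHodgeClass_iff (hQ : Q.PosDef) (hJ : Q * weilJ 4 = weilJ 4 * Q) (hgen : IsWeilGeneric 4 Q)
    (C : (Fin 4 → Fin (2 * 4)) → (Fin 4 → Fin (2 * 4)) → ℝ) :
    (∃ y : (Fin 4 → Fin (2 * 4)) → (Fin 4 → Fin (2 * 4)) → ℤ,
      (∀ (c d : Fin 4 → Fin (2 * 4)) (τ : Equiv.Perm (Fin 4)),
          y (c ∘ τ) d = ((Equiv.Perm.sign τ : ℤˣ) : ℤ) * y c d) ∧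
      (∀ (c d : Fin 4 → Fin (2 * 4)) (τ : Equiv.Perm (Fin 4)),
          y c (d ∘ τ) = ((Equiv.Perm.sign τ : ℤˣ) : ℤ) * y c d) ∧
      C = cl⟦Q⟧ y ∧
      ∀ (K' : Fin 5 → Fin (2 * 4)) (J' : Fin 3 → Fin (2 * 4)),
        ∑ m : Fin 5, (-1 : ℝ) ^ (m : ℕ) * C (fun a => K' (m.succAbove a)) (Fin.cons (K' m) J') = 0) ↔
    ∃ a b c : ℤ, C = (a : ℝ) • θ⟦4⟧ Q + (b : ℝ) • wRe⟦4⟧ Q + (c : ℝ) • wIm⟦4⟧ Q := by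
  have hS : ∀ α β, Q α β = Q β α := fun α β => by
    simpa using (hQ.isHermitian.apply α β).symm
  constructor
  · rintro ⟨y, hyI, hyJ, rfl, heig⟩
    exact cl_eq_of_eigenwave Q hS hJ hgen y hyI hyJ heig
  · rintro ⟨a, b, c, rfl⟩
    refine ⟨fun I J => a * Chk.thetaZ I J - (-b) * (Chk.wG I J).re - (-c) * (Chk.wG I J).im,
      fun I J τ => Chk.classes_perm_left a (-b) (-c) I J τ,
      fun I J τ => Chk.classes_perm_right a (-b) (-c) I J τ, ?_, ?_⟩
    · rw [cl_classes]
      simp only [Int.cast_neg, neg_smul, sub_neg_eq_add]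
    · intro K' J'
      have hθ := thetaClass_eigenwave Q hQ.posSemidef K' J'
      have hre := weilClassRe_eigenwave Q hJ K' J'
      have him := weilClassIm_eigenwave Q hJ K' J'
      beta_reduce at hθ hre him
      simp only [Pi.add_apply, Pi.smul_apply, smul_eq_mul]
      have e : ∑ m : Fin 5, (-1 : ℝ) ^ (m : ℕ) *
          ((a : ℝ) * (Q.submatrix (fun a' => K' (m.succAbove a')) (Fin.cons (K' m) J')).det +
            (b : ℝ) * ((wC⟦4⟧ Q) (fun a' => K' (m.succAbove a')) (Fin.cons (K' m) J')).re +
            (c : ℝ) * ((wC⟦4⟧ Q) (fun a' => K' (m.succAbove a')) (Fin.cons (K' m) J')).im) =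
          (a : ℝ) * ∑ m : Fin 5, (-1 : ℝ) ^ (m : ℕ) *
              (Q.submatrix (fun a' => K' (m.succAbove a')) (Fin.cons (K' m) J')).det +
          (b : ℝ) * ∑ m : Fin 5, (-1 : ℝ) ^ (m : ℕ) *
              ((wC⟦4⟧ Q) (fun a' => K' (m.succAbove a')) (Fin.cons (K' m) J')).re +
          (c : ℝ) * ∑ m : Fin 5, (-1 : ℝ) ^ (m : ℕ) *
              ((wC⟦4⟧ Q) (fun a' => K' (m.succAbove a')) (Fin.cons (K' m) J')).im := by
        rw [Finset.mul_sum, Finset.mul_sum, Finset.mul_sum, ← Finset.sum_add_distrib, ← Finset.sum_add_distrib]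
        refine Finset.sum_congr rfl fun m _ => ?_
        ring
      beta_reduce at e
      rw [e, hθ, hre, him]
      ring

end Classification

end Summit.HodgeConjecture.HodgeConjecture.Theorems.TropicalHodgeBound

end
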